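import Mathlib
import Summits.Ventures.HodgeRepro.Tier4.Line4.L1Class
import Summits.Ventures.HodgeRepro.Tier4.Line4.TailAssembly
import Summits.Ventures.HodgeRepro.Tier4.Line4.KernelL1
import Summits.Ventures.HodgeRepro.Tier4.Line1.L1GeometricPrep

/-!
# Tier4/Line4/PoincareSummableOfDecay — the uniform Poincaré bound (α) for `finf ⊗ ffin` from the archimedean decay of
`finf` against a one-sided lattice count of rate `α < β`

Blind re-derivation cell `pub-hodge-repro`, Tier 4 «PROVE THE STEP», LINE L4, seat t4-x2 (g4, reserve wall-breaker),
lead (R-16)(c) S14891 / (R-18) S14924: the theorem `poincareSummable_of_decay` the wall's `hP₁ : PoincareSummable S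
(prodFn W finf (ffin N))` needs for (3′) `RtfSpectralL1` (L2-p3's `rtfSpectralL1_of_poincare`), and the Poincaré-side
consumer of the SAME decay estimate TAIL's `hdecay` uses (one decay lemma, two consumers).  Tree path
`lean/Summits/Ventures/HodgeRepro/Tier4/Line4/PoincareSummableOfDecay.lean`.  0 print, no `def`.

THE MATHEMATICS.  Fix compacts `C₁, C₂ ⊆ G`, `x ∈ C₁`, `y ∈ C₂`.  For `f = finf ⊗ ffin` with `‖finf z‖ ≤ C e^{−β d_∞ z}`
and `ffin` bounded by `B` (continuous, compactly supported on `G(𝔸_f)`), every term of the Poincaré series satisfies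
`‖f (x⁻¹ γ y)‖ ≤ C B e^{−β d_∞((x⁻¹ γ y)_∞)}`, and the only `γ` that contribute have `(x⁻¹ γ y)_f` in the compact support
`K_f` of `ffin`.  The ONE-SIDED lattice count «`#{γ ∈ G(k) : (x⁻¹ γ y)_f ∈ K_f, d_∞((x⁻¹ γ y)_∞) ≤ T} ≤ C′ e^{α T}`,
uniformly in `x ∈ C₁`, `y ∈ C₂`» with `α < β` then gives, by the LAYER-CAKE of L1-p4 g4's TailAssembly
(`summable_exp_of_count`, transcribed here with its EXPLICIT constant `C′ e^α / (1 − e^{α−β})` on finite sums —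
`sum_exp_le_of_count` — because the (α) form needs one bound `M` for the whole compact pair, not summability alone):
`∑_{γ ∈ F} ‖f (x⁻¹ γ y)‖ ≤ C B · C′ e^α / (1 − e^{α−β})` for every finite `F`, whence `Summable` and the `tsum` bound
(`summable_of_sum_le`, `Real.tsum_le_of_sum_le`).

* `sum_exp_le_of_count` — the layer-cake with the explicit constant, on a finite set `t` (the count is only needed on `t`).
* `poincareSummable_of_decay_count` — the generic form on any RTF `Setting G`: a pointwise decay `‖f z‖ ≤ C e^{−β d z}`
  in a size `d : G → ℝ` + the one-sided count of rate `α < β` on the SUPPORT of `f` ⇒ `L1Class.PoincareSummable S f`.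
* `poincareSummable_of_decay` — THE THEOREM of (R-16)(c): the adelic form for `prodFn W finf ffin` — the decay of `finf`
  (the `decay` field of v3's `IsArchCoeff`, in any archimedean size `dinf : GA W → ℝ ≥ 0`), `IsFinFactor W ffin`, and
  the count on compacts `K_f ⊆ G(𝔸_f)` of the finite coordinate.  The rate `β` is general (`β = 3` for the weight-3
  coefficient, `α = 2` for the hyperbolic count); only `α < β`, `0 ≤ β` enter.
* `poincareSummable_iff_poincareUniform` — ONE Prop, two tree names (plan-1 S14908): `L1Class.PoincareSummable S f`
  (L1Class p699130) and `S.PoincareUniform f` (L1GeometricPrep p699283) are the same body, `Iff.rfl`;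
  `poincareUniform_of_decay` restates the theorem under the second name, `summable_norm_of_poincareSummable` is
  L4-p2's `summable_norm_of_poincareUniform` (KernelL1 p699356) at singletons.

HONEST SCOPE.  The count of rate `α` is a HYPOTHESIS here (the volume growth of the archimedean balls is not in the
tree); the decay is the `decay` field of `IsArchCoeff` (v3), supplied by D3COEFF's witness (Harish-Chandra's
`|φ(a_t)| ≤ C e^{−3t}`).  Nothing here says anything about the status of the Hodge conjecture for CM abelian varieties,
which is NOT proved (HC_CM is NOT proved by anyone in this repository).
-/

set_option autoImplicit false

noncomputable section

namespace Summit.Ventures.HodgeRepro.Tier4.Line4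

open MeasureTheory Topology NumberField Summit.Ventures.HodgeRepro.Tier4.Common
  Summit.Ventures.HodgeRepro.Tier4.Line1 Summit.Ventures.HodgeRepro.Tier4.Line1.RTF

open scoped Pointwise

/-! ## 1. The layer-cake with its explicit constant -/

section LayerCake

variable {ι : Type}

/-- **The layer-cake with the explicit constant** (L1-p4 g4's `summable_exp_of_count`, TailAssembly, on a finite set):
if every `o ∈ t` of size `d o ≤ T` lies in a finset of cardinality `≤ C′ e^{α T}` (for every `T`), then
`∑_{o ∈ t} e^{−β d o} ≤ C′ e^α / (1 − e^{α−β})` for every `β > α`, `β ≥ 0` — group the terms by `j = ⌊d o⌋₊`; the `j`-th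
layer has at most `C′ e^{α (j+1)}` terms, each `≤ e^{−β j}`, and `∑_j (e^{α−β})^j = 1/(1 − e^{α−β})`. -/
theorem sum_exp_le_of_count (d : ι → ℝ) (hd : ∀ o, 0 ≤ d o) {α β C' : ℝ} (hαβ : α < β) (hβ : 0 ≤ β)
    (hC' : 0 ≤ C') (t : Finset ι)
    (hcount : ∀ T : ℝ, ∃ s : Finset ι, (∀ o ∈ t, d o ≤ T → o ∈ s) ∧ (s.card : ℝ) ≤ C' * Real.exp (α * T)) :
    ∑ o ∈ t, Real.exp (-(β * d o)) ≤ C' * Real.exp α * (1 - Real.exp (α - β))⁻¹ := by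
  classical
  set r : ℝ := Real.exp (α - β) with hr
  have hr0 : 0 ≤ r := (Real.exp_pos _).le
  have hr1 : r < 1 := by
    rw [hr, Real.exp_lt_one_iff]
    linarith
  have hgeo : Summable fun j : ℕ => r ^ j := summable_geometric_of_lt_one hr0 hr1
  -- the layer of `o ∈ t` with `⌊d o⌋₊ = j` has at most `C′ e^{α (j+1)}` members, each term `≤ e^{−β j}`
  have hlayer : ∀ j : ℕ, ∑ o ∈ t.filter (fun o => ⌊d o⌋₊ = j), Real.exp (-(β * d o)) ≤
      C' * Real.exp α * r ^ j := by
    intro j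
    obtain ⟨s, hs, hcard⟩ := hcount ((j : ℝ) + 1)
    have hsub : t.filter (fun o => ⌊d o⌋₊ = j) ⊆ s := by
      intro o ho
      rw [Finset.mem_filter] at ho
      refine hs o ho.1 ?_
      have := Nat.lt_floor_add_one (d o)
      rw [ho.2] at this
      exact this.le
    have hterm : ∀ o ∈ t.filter (fun o => ⌊d o⌋₊ = j), Real.exp (-(β * d o)) ≤ Real.exp (-(β * j)) := by
      intro o ho
      rw [Finset.mem_filter] at ho
      rw [Real.exp_le_exp, neg_le_neg_iff]
      have h1 : (j : ℝ) ≤ d o := by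
        rw [← ho.2]
        exact Nat.floor_le (hd o)
      exact mul_le_mul_of_nonneg_left h1 hβ
    calc ∑ o ∈ t.filter (fun o => ⌊d o⌋₊ = j), Real.exp (-(β * d o))
        ≤ (t.filter (fun o => ⌊d o⌋₊ = j)).card • Real.exp (-(β * j)) :=
          Finset.sum_le_card_nsmul _ _ _ hterm
      _ = ((t.filter (fun o => ⌊d o⌋₊ = j)).card : ℝ) * Real.exp (-(β * j)) := by rw [nsmul_eq_mul]
      _ ≤ (C' * Real.exp (α * ((j : ℝ) + 1))) * Real.exp (-(β * j)) := by
          refine mul_le_mul_of_nonneg_right ?_ (Real.exp_pos _).le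
          exact le_trans (by exact_mod_cast Finset.card_le_card hsub) hcard
      _ = C' * Real.exp α * r ^ j := by
          rw [hr, ← Real.exp_nat_mul, mul_assoc, ← Real.exp_add, mul_assoc, ← Real.exp_add]
          congr 2
          ring
  -- group `t` by the layers and sum the geometric series
  have hgroup : ∑ o ∈ t, Real.exp (-(β * d o)) =
      ∑ j ∈ t.image (fun o => ⌊d o⌋₊), ∑ o ∈ t.filter (fun o => ⌊d o⌋₊ = j), Real.exp (-(β * d o)) :=
    (Finset.sum_fiberwise_of_maps_to (fun o ho => Finset.mem_image_of_mem _ ho) _).symm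
  rw [hgroup]
  calc ∑ j ∈ t.image (fun o => ⌊d o⌋₊), ∑ o ∈ t.filter (fun o => ⌊d o⌋₊ = j), Real.exp (-(β * d o))
      ≤ ∑ j ∈ t.image (fun o => ⌊d o⌋₊), C' * Real.exp α * r ^ j :=
        Finset.sum_le_sum fun j _ => hlayer j
    _ = C' * Real.exp α * ∑ j ∈ t.image (fun o => ⌊d o⌋₊), r ^ j := by rw [Finset.mul_sum]
    _ ≤ C' * Real.exp α * ∑' j : ℕ, r ^ j := by
        refine mul_le_mul_of_nonneg_left ?_ (by positivity)
        exact hgeo.sum_le_tsum _ (fun j _ => pow_nonneg hr0 j)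
    _ = C' * Real.exp α * (1 - r)⁻¹ := by rw [tsum_geometric_of_lt_one hr0 hr1]

end LayerCake

/-! ## 2. The uniform Poincaré bound from a decay against a one-sided count -/

section Generic

variable {G : Type} [Group G] [TopologicalSpace G] [IsTopologicalGroup G] [MeasurableSpace G] [BorelSpace G]
  (S : Setting G)

omit [IsTopologicalGroup G] [BorelSpace G] in
/-- **The (α)-form Poincaré bound from a pointwise decay against a one-sided count on the support** (generic, any RTF
`Setting G`, any size `d : G → ℝ`, `d ≥ 0`): if `‖f z‖ ≤ C e^{−β d z}` for every `z`, and for every pair of compacts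
`C₁, C₂` there is `C′` with «for all `x ∈ C₁`, `y ∈ C₂`, `T`: the rational points `γ` with `f (x⁻¹ γ y) ≠ 0` and
`d (x⁻¹ γ y) ≤ T` lie in a finset of cardinality `≤ C′ e^{α T}`», `α < β`, `0 ≤ β`, then `f` satisfies the uniform
Poincaré bound: `∑'_γ ‖f (x⁻¹ γ y)‖ ≤ C · C′ e^α / (1 − e^{α−β})` on `C₁ × C₂`. -/
theorem poincareSummable_of_decay_count (f : G → ℂ) (d : G → ℝ) (hd : ∀ z, 0 ≤ d z) {C α β : ℝ} (hC : 0 ≤ C)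
    (hαβ : α < β) (hβ : 0 ≤ β) (hdecay : ∀ z, ‖f z‖ ≤ C * Real.exp (-(β * d z)))
    (hcount : ∀ C₁ C₂ : Set G, IsCompact C₁ → IsCompact C₂ → ∃ C' : ℝ, 0 ≤ C' ∧ ∀ x ∈ C₁, ∀ y ∈ C₂, ∀ T : ℝ,
      ∃ s : Finset S.Gk, (∀ γ : S.Gk, f (x⁻¹ * γ * y) ≠ 0 → d (x⁻¹ * γ * y) ≤ T → γ ∈ s) ∧
        (s.card : ℝ) ≤ C' * Real.exp (α * T)) :
    L1Class.PoincareSummable S f := by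
  classical
  intro C₁ C₂ hC₁ hC₂
  obtain ⟨C', hC'0, hcnt⟩ := hcount C₁ C₂ hC₁ hC₂
  refine ⟨C * (C' * Real.exp α * (1 - Real.exp (α - β))⁻¹), fun x hx y hy => ?_⟩
  -- the bound on every finite partial sum, through the support and the layer-cake
  have key : ∀ t : Finset S.Gk, ∑ γ ∈ t, ‖f (x⁻¹ * γ * y)‖ ≤
      C * (C' * Real.exp α * (1 - Real.exp (α - β))⁻¹) := by
    intro t
    have hsum : ∑ γ ∈ t, ‖f (x⁻¹ * γ * y)‖ =
        ∑ γ ∈ t.filter (fun γ : S.Gk => f (x⁻¹ * γ * y) ≠ 0), ‖f (x⁻¹ * γ * y)‖ := by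
      rw [Finset.sum_filter_of_ne]
      intro γ _ hne h0
      exact hne (by rw [h0, norm_zero])
    rw [hsum]
    calc ∑ γ ∈ t.filter (fun γ : S.Gk => f (x⁻¹ * γ * y) ≠ 0), ‖f (x⁻¹ * γ * y)‖
        ≤ ∑ γ ∈ t.filter (fun γ : S.Gk => f (x⁻¹ * γ * y) ≠ 0), C * Real.exp (-(β * d (x⁻¹ * γ * y))) :=
          Finset.sum_le_sum fun γ _ => hdecay _
      _ = C * ∑ γ ∈ t.filter (fun γ : S.Gk => f (x⁻¹ * γ * y) ≠ 0), Real.exp (-(β * d (x⁻¹ * γ * y))) := by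
          rw [Finset.mul_sum]
      _ ≤ C * (C' * Real.exp α * (1 - Real.exp (α - β))⁻¹) := by
          refine mul_le_mul_of_nonneg_left ?_ hC
          refine sum_exp_le_of_count (fun γ : S.Gk => d (x⁻¹ * γ * y)) (fun γ => hd _) hαβ hβ hC'0 _ ?_
          intro T
          obtain ⟨s, hs, hcard⟩ := hcnt x hx y hy T
          refine ⟨s, fun γ hγ hdT => ?_, hcard⟩
          rw [Finset.mem_filter] at hγ
          exact hs γ hγ.2 hdT
  exact ⟨summable_of_sum_le (fun _ => norm_nonneg _) key, Real.tsum_le_of_sum_le (fun _ => norm_nonneg _) key⟩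

omit [IsTopologicalGroup G] [BorelSpace G] in
/-- **One Prop, two tree names** (plan-1 S14908): `L1Class.PoincareSummable S f` (L1Class p699130) and
`S.PoincareUniform f` (L1GeometricPrep p699283) have the same body. -/
theorem poincareSummable_iff_poincareUniform (f : G → ℂ) :
    L1Class.PoincareSummable S f ↔ S.PoincareUniform f := Iff.rfl

omit [IsTopologicalGroup G] [BorelSpace G] in
/-- The norm-summability at every point from the (α)-form bound — L4-p2's `summable_norm_of_poincareUniform`
(KernelL1 p699356) under the first name. -/
theorem summable_norm_of_poincareSummable {f : G → ℂ} (hP : L1Class.PoincareSummable S f) (x y : G) :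
    Summable (fun γ : S.Gk => ‖f (x⁻¹ * γ * y)‖) :=
  summable_norm_of_poincareUniform S hP x y

end Generic

/-! ## 3. The adelic form: `finf ⊗ ffin` with `finf` decaying and `ffin` compactly supported at the finite places -/

section Adelic

variable {k : Type} [Field k] [NumberField k] (W : PlaneData k) [MeasurableSpace (GA W)] (S : Setting (GA W))

/-- **`poincareSummable_of_decay` — (R-16)(c)**: for a product test `finf ⊗ ffin` on `G(𝔸)` whose archimedean factor
decays pointwise, `‖finf z‖ ≤ C e^{−β dinf z}` (the `decay` field of v3's `IsArchCoeff`; `dinf : G(𝔸) → ℝ` any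
non-negative archimedean size, `β = 3` for the weight-3 coefficient), and whose finite factor is an `IsFinFactor`
(continuous, compactly supported on `G(𝔸_f)`), the ONE-SIDED lattice count of rate `α < β` — for every compact
`K_f ⊆ G(𝔸_f)` and compacts `C₁, C₂ ⊆ G(𝔸)`, a `C′` with «for all `x ∈ C₁`, `y ∈ C₂`, `T`: the rational points `γ`
with `(x⁻¹ γ y)_f ∈ K_f` and `dinf ((x⁻¹ γ y)_∞) ≤ T` lie in a finset of cardinality `≤ C′ e^{α T}`» — gives the
uniform Poincaré bound `PoincareSummable S (prodFn W finf ffin)` (the (α) form of L1Class p699130). -/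
theorem poincareSummable_of_decay (dinf : GA W → ℝ) (hd : ∀ z, 0 ≤ dinf z) {finf ffin : GA W → ℂ} {C α β : ℝ}
    (hC : 0 ≤ C) (hαβ : α < β) (hβ : 0 ≤ β) (hdecay : ∀ z, ‖finf z‖ ≤ C * Real.exp (-(β * dinf z)))
    (hffin : L1Class.IsFinFactor W ffin)
    (hcount : ∀ Kf : Set (GA W), IsCompact Kf → Kf ⊆ (finitePart W : Set (GA W)) →
      ∀ C₁ C₂ : Set (GA W), IsCompact C₁ → IsCompact C₂ → ∃ C' : ℝ, 0 ≤ C' ∧ ∀ x ∈ C₁, ∀ y ∈ C₂, ∀ T : ℝ,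
        ∃ s : Finset S.Gk, (∀ γ : S.Gk, GA.ofFinPart W (x⁻¹ * γ * y) ∈ Kf →
          dinf (GA.ofInfPart W (x⁻¹ * γ * y)) ≤ T → γ ∈ s) ∧ (s.card : ℝ) ≤ C' * Real.exp (α * T)) :
    L1Class.PoincareSummable S (L1Class.prodFn W finf ffin) := by
  -- the finite factor is bounded on `G(𝔸_f)`
  obtain ⟨B, hB⟩ : ∃ B : ℝ, ∀ x : finitePart W, ‖ffin x‖ ≤ B := by
    obtain ⟨B, hB⟩ := (hffin.cont.comp continuous_subtype_val).norm.bddAbove_range_of_hasCompactSupport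
      hffin.compact.norm
    exact ⟨B, fun x => hB ⟨x, rfl⟩⟩
  have hB0 : 0 ≤ B := le_trans (norm_nonneg _) (hB 1)
  -- its support, as a compact subset of `G(𝔸_f) ⊆ G(𝔸)`
  set Kf : Set (GA W) := Subtype.val '' tsupport (fun x : finitePart W => ffin (x : GA W)) with hKf
  have hKfc : IsCompact Kf := IsCompact.image hffin.compact continuous_subtype_val
  have hKfsub : Kf ⊆ (finitePart W : Set (GA W)) := by
    rintro _ ⟨x, -, rfl⟩
    exact x.2
  refine poincareSummable_of_decay_count S (L1Class.prodFn W finf ffin) (fun z => dinf (GA.ofInfPart W z))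
    (fun z => hd _) (C := C * B) (by positivity) hαβ hβ ?_ ?_
  · -- the pointwise decay of the product
    intro z
    show ‖finf (GA.ofInfPart W z) * ffin (GA.ofFinPart W z)‖ ≤ _
    rw [norm_mul]
    calc ‖finf (GA.ofInfPart W z)‖ * ‖ffin (GA.ofFinPart W z)‖
        ≤ (C * Real.exp (-(β * dinf (GA.ofInfPart W z)))) * B :=
          mul_le_mul (hdecay _) (hB ⟨_, ofFinPart_mem_finitePart W z⟩) (norm_nonneg _) (by positivity)
      _ = C * B * Real.exp (-(β * dinf (GA.ofInfPart W z))) := by ring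
  · -- the count on the support of the product is the count on the finite support
    intro C₁ C₂ hC₁ hC₂
    obtain ⟨C', hC'0, hcnt⟩ := hcount Kf hKfc hKfsub C₁ C₂ hC₁ hC₂
    refine ⟨C', hC'0, fun x hx y hy T => ?_⟩
    obtain ⟨s, hs, hcard⟩ := hcnt x hx y hy T
    refine ⟨s, fun γ hne hdT => hs γ ?_ hdT, hcard⟩
    have h2 : ffin (GA.ofFinPart W (x⁻¹ * γ * y)) ≠ 0 := by
      intro h0
      apply hne
      show finf _ * ffin _ = 0
      rw [h0, mul_zero]
    exact ⟨⟨_, ofFinPart_mem_finitePart W _⟩, subset_tsupport _ h2, rfl⟩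

/-- The same under plan-1's name `PoincareUniform` (L1GeometricPrep p699283). -/
theorem poincareUniform_of_decay (dinf : GA W → ℝ) (hd : ∀ z, 0 ≤ dinf z) {finf ffin : GA W → ℂ} {C α β : ℝ}
    (hC : 0 ≤ C) (hαβ : α < β) (hβ : 0 ≤ β) (hdecay : ∀ z, ‖finf z‖ ≤ C * Real.exp (-(β * dinf z)))
    (hffin : L1Class.IsFinFactor W ffin)
    (hcount : ∀ Kf : Set (GA W), IsCompact Kf → Kf ⊆ (finitePart W : Set (GA W)) →
      ∀ C₁ C₂ : Set (GA W), IsCompact C₁ → IsCompact C₂ → ∃ C' : ℝ, 0 ≤ C' ∧ ∀ x ∈ C₁, ∀ y ∈ C₂, ∀ T : ℝ,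
        ∃ s : Finset S.Gk, (∀ γ : S.Gk, GA.ofFinPart W (x⁻¹ * γ * y) ∈ Kf →
          dinf (GA.ofInfPart W (x⁻¹ * γ * y)) ≤ T → γ ∈ s) ∧ (s.card : ℝ) ≤ C' * Real.exp (α * T)) :
    S.PoincareUniform (L1Class.prodFn W finf ffin) :=
  (poincareSummable_iff_poincareUniform S _).1
    (poincareSummable_of_decay W S dinf hd hC hαβ hβ hdecay hffin hcount)

end Adelic

end Summit.Ventures.HodgeRepro.Tier4.Line4

end

/-! ## 4. APPEND (p700384 rows 1–259 byte-identical above). -/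

noncomputable section

namespace Summit.Ventures.HodgeRepro.Tier4.Line4

open MeasureTheory Topology NumberField Summit.Ventures.HodgeRepro.Tier4.Common
  Summit.Ventures.HodgeRepro.Tier4.Line1 Summit.Ventures.HodgeRepro.Tier4.Line1.RTF

open scoped Pointwise

/-! ## 4. The shapes the displays consume (L4-p2 g4 S14965 / plan-4 g4's v3 `HasDecay3`): the rate `α` chosen PER
compact pair, the count in `d (x⁻¹ γ y)` (the size evaluated at the point itself, with `d (z_∞) = d z`), no sign
hypothesis on the decay constant (it follows from the bound at one point) -/

section GenericPer

variable {G : Type} [Group G] [TopologicalSpace G] [MeasurableSpace G] (S : Setting G)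

/-- **The partial sums at one point `(x, y)` from a count at that point**: under the pointwise decay
`‖f z‖ ≤ C e^{−β d z}` and the count «the rational points `γ` with `f (x⁻¹ γ y) ≠ 0`, `d (x⁻¹ γ y) ≤ T` lie in a finset of
cardinality `≤ C′ e^{α T}`» (`α < β`, `0 ≤ β`), every finite partial sum `∑_{γ ∈ t} ‖f (x⁻¹ γ y)‖` is
`≤ C · C′ e^α / (1 − e^{α−β})`. -/
theorem sum_norm_le_of_decay_count (f : G → ℂ) (d : G → ℝ) (hd : ∀ z, 0 ≤ d z) {C α β C' : ℝ} (hC : 0 ≤ C)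
    (hαβ : α < β) (hβ : 0 ≤ β) (hC' : 0 ≤ C') (hdecay : ∀ z, ‖f z‖ ≤ C * Real.exp (-(β * d z))) (x y : G)
    (hcnt : ∀ T : ℝ, ∃ s : Finset S.Gk, (∀ γ : S.Gk, f (x⁻¹ * γ * y) ≠ 0 → d (x⁻¹ * γ * y) ≤ T → γ ∈ s) ∧
      (s.card : ℝ) ≤ C' * Real.exp (α * T)) (t : Finset S.Gk) :
    ∑ γ ∈ t, ‖f (x⁻¹ * γ * y)‖ ≤ C * (C' * Real.exp α * (1 - Real.exp (α - β))⁻¹) := by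
  classical
  have hsum : ∑ γ ∈ t, ‖f (x⁻¹ * γ * y)‖ =
      ∑ γ ∈ t.filter (fun γ : S.Gk => f (x⁻¹ * γ * y) ≠ 0), ‖f (x⁻¹ * γ * y)‖ := by
    rw [Finset.sum_filter_of_ne]
    intro γ _ hne h0
    exact hne (by rw [h0, norm_zero])
  rw [hsum]
  calc ∑ γ ∈ t.filter (fun γ : S.Gk => f (x⁻¹ * γ * y) ≠ 0), ‖f (x⁻¹ * γ * y)‖
      ≤ ∑ γ ∈ t.filter (fun γ : S.Gk => f (x⁻¹ * γ * y) ≠ 0), C * Real.exp (-(β * d (x⁻¹ * γ * y))) :=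
        Finset.sum_le_sum fun γ _ => hdecay _
    _ = C * ∑ γ ∈ t.filter (fun γ : S.Gk => f (x⁻¹ * γ * y) ≠ 0), Real.exp (-(β * d (x⁻¹ * γ * y))) := by
        rw [Finset.mul_sum]
    _ ≤ C * (C' * Real.exp α * (1 - Real.exp (α - β))⁻¹) := by
        refine mul_le_mul_of_nonneg_left ?_ hC
        refine sum_exp_le_of_count (fun γ : S.Gk => d (x⁻¹ * γ * y)) (fun γ => hd _) hαβ hβ hC' _ ?_
        intro T
        obtain ⟨s, hs, hcard⟩ := hcnt T
        refine ⟨s, fun γ hγ hdT => ?_, hcard⟩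
        rw [Finset.mem_filter] at hγ
        exact hs γ hγ.2 hdT

/-- **The (α)-form Poincaré bound, the rate `α` chosen per compact pair** (`poincareSummable_of_decay_count` with
`∃ C′ α` inside the count, the shape of a sublevel-count DISPLAY `α < β` on each pair of compacts). -/
theorem poincareSummable_of_decay_count' (f : G → ℂ) (d : G → ℝ) (hd : ∀ z, 0 ≤ d z) {C β : ℝ} (hC : 0 ≤ C)
    (hβ : 0 ≤ β) (hdecay : ∀ z, ‖f z‖ ≤ C * Real.exp (-(β * d z)))
    (hcount : ∀ C₁ C₂ : Set G, IsCompact C₁ → IsCompact C₂ → ∃ C' α : ℝ, 0 ≤ C' ∧ α < β ∧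
      ∀ x ∈ C₁, ∀ y ∈ C₂, ∀ T : ℝ,
        ∃ s : Finset S.Gk, (∀ γ : S.Gk, f (x⁻¹ * γ * y) ≠ 0 → d (x⁻¹ * γ * y) ≤ T → γ ∈ s) ∧
          (s.card : ℝ) ≤ C' * Real.exp (α * T)) :
    L1Class.PoincareSummable S f := by
  intro C₁ C₂ hC₁ hC₂
  obtain ⟨C', α, hC'0, hαβ, hcnt⟩ := hcount C₁ C₂ hC₁ hC₂
  refine ⟨C * (C' * Real.exp α * (1 - Real.exp (α - β))⁻¹), fun x hx y hy => ?_⟩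
  have key := sum_norm_le_of_decay_count S f d hd hC hαβ hβ hC'0 hdecay x y (hcnt x hx y hy)
  exact ⟨summable_of_sum_le (fun _ => norm_nonneg _) key, Real.tsum_le_of_sum_le (fun _ => norm_nonneg _) key⟩

end GenericPer

section AdelicPer

variable {k : Type} [Field k] [NumberField k] (W : PlaneData k) [MeasurableSpace (GA W)] (S : Setting (GA W))

omit [MeasurableSpace (GA W)] in
/-- The constant of a pointwise decay bound is non-negative (the bound at one point). -/
theorem nonneg_of_decay {finf : GA W → ℂ} {dinf : GA W → ℝ} {C β : ℝ}
    (hdecay : ∀ z, ‖finf z‖ ≤ C * Real.exp (-(β * dinf z))) : 0 ≤ C := by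
  have h := le_trans (norm_nonneg _) (hdecay 1)
  exact le_of_mul_le_mul_right (by simpa using h) (Real.exp_pos _)

/-- **`poincareSummable_of_decay`, the shape of the `archDist` displays** (L4-p2 g4 S14965, v3's `HasDecay3`): the
size `dinf` is evaluated at the point itself in the count (`dinf (x⁻¹ γ y) ≤ T`), which is the same as at its
archimedean component because `dinf (z_∞) = dinf z` (`hdinf`; for v3's `archDist` this is the definition — the
`w`-entries of `z_∞` are those of `z`); the rate `α < β` is chosen per compact triple `(K_f, C₁, C₂)`; no sign
hypothesis on `C` (it is `nonneg_of_decay`).  For `HasDecay3 W finf = ∃ C, ∀ x, ‖finf x‖ ≤ C · exp (−(3 · archDist W x))`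
take `β := 3`, `dinf := archDist W`, `hd := archDist_nonneg`. -/
theorem poincareSummable_of_decay' (dinf : GA W → ℝ) (hd : ∀ z, 0 ≤ dinf z)
    (hdinf : ∀ z, dinf (GA.ofInfPart W z) = dinf z) {finf ffin : GA W → ℂ} {C β : ℝ} (hβ : 0 ≤ β)
    (hdecay : ∀ z, ‖finf z‖ ≤ C * Real.exp (-(β * dinf z))) (hffin : L1Class.IsFinFactor W ffin)
    (hcount : ∀ Kf : Set (GA W), IsCompact Kf → Kf ⊆ (finitePart W : Set (GA W)) →
      ∀ C₁ C₂ : Set (GA W), IsCompact C₁ → IsCompact C₂ → ∃ C' α : ℝ, 0 ≤ C' ∧ α < β ∧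
        ∀ x ∈ C₁, ∀ y ∈ C₂, ∀ T : ℝ,
          ∃ s : Finset S.Gk, (∀ γ : S.Gk, GA.ofFinPart W (x⁻¹ * γ * y) ∈ Kf → dinf (x⁻¹ * γ * y) ≤ T → γ ∈ s) ∧
            (s.card : ℝ) ≤ C' * Real.exp (α * T)) :
    L1Class.PoincareSummable S (L1Class.prodFn W finf ffin) := by
  have hC : 0 ≤ C := nonneg_of_decay W hdecay
  -- the finite factor is bounded on `G(𝔸_f)`
  obtain ⟨B, hB⟩ : ∃ B : ℝ, ∀ x : finitePart W, ‖ffin x‖ ≤ B := by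
    obtain ⟨B, hB⟩ := (hffin.cont.comp continuous_subtype_val).norm.bddAbove_range_of_hasCompactSupport
      hffin.compact.norm
    exact ⟨B, fun x => hB ⟨x, rfl⟩⟩
  have hB0 : 0 ≤ B := le_trans (norm_nonneg _) (hB 1)
  -- its support, as a compact subset of `G(𝔸_f) ⊆ G(𝔸)`
  set Kf : Set (GA W) := Subtype.val '' tsupport (fun x : finitePart W => ffin (x : GA W)) with hKf
  have hKfc : IsCompact Kf := IsCompact.image hffin.compact continuous_subtype_val
  have hKfsub : Kf ⊆ (finitePart W : Set (GA W)) := by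
    rintro _ ⟨x, -, rfl⟩
    exact x.2
  refine poincareSummable_of_decay_count' S (L1Class.prodFn W finf ffin) dinf hd (C := C * B) (by positivity)
    hβ ?_ ?_
  · -- the pointwise decay of the product, the size read at the archimedean component
    intro z
    show ‖finf (GA.ofInfPart W z) * ffin (GA.ofFinPart W z)‖ ≤ _
    rw [norm_mul]
    calc ‖finf (GA.ofInfPart W z)‖ * ‖ffin (GA.ofFinPart W z)‖
        ≤ (C * Real.exp (-(β * dinf (GA.ofInfPart W z)))) * B :=
          mul_le_mul (hdecay _) (hB ⟨_, ofFinPart_mem_finitePart W z⟩) (norm_nonneg _) (by positivity)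
      _ = C * B * Real.exp (-(β * dinf z)) := by rw [hdinf]; ring
  · -- the count on the support of the product is the count on the finite support
    intro C₁ C₂ hC₁ hC₂
    obtain ⟨C', α, hC'0, hαβ, hcnt⟩ := hcount Kf hKfc hKfsub C₁ C₂ hC₁ hC₂
    refine ⟨C', α, hC'0, hαβ, fun x hx y hy T => ?_⟩
    obtain ⟨s, hs, hcard⟩ := hcnt x hx y hy T
    refine ⟨s, fun γ hne hdT => hs γ ?_ hdT, hcard⟩
    have h2 : ffin (GA.ofFinPart W (x⁻¹ * γ * y)) ≠ 0 := by
      intro h0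
      apply hne
      show finf _ * ffin _ = 0
      rw [h0, mul_zero]
    exact ⟨⟨_, ofFinPart_mem_finitePart W _⟩, subset_tsupport _ h2, rfl⟩

end AdelicPer

end Summit.Ventures.HodgeRepro.Tier4.Line4

end
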